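import Mathlib
import HarnessLib
import Literature.Probability.LatticeModels.TorusMomentumProductGrid
import Summits.HubbardSuperconductivity.HubbardSuperconductivity.Theorems.KLProgrammeKLRegimeVolumeLimitGridRefinement
import Summits.HubbardSuperconductivity.HubbardSuperconductivity.Theorems.KLProgrammeKLRegimeVolumeLimitCauchyTermwise
import Summits.HubbardSuperconductivity.HubbardSuperconductivity.Theorems.KLProgrammeKLRegimeEngineValueClauseReduction

/-!
# Route `KLProgramme` — crux K3, child «VolumeLimit» (stmt-HubbardSuperconductivity-19921 `KLRegimeVolumeLimitV14`):
# the two-volume calculus of GRID FAMILIES — routing along integer matrices, products, loop averages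
# (cell gate-hubbard-kl, seat hubbard-kl-k3c4-p1 g5, technique «volume lemmas»; `--supports` the VolumeLimit child)

The registered Cauchy stub `stub_vl_twoVolumeRate` (skeleton «cauchy» on 19921) and all its doors
(`…VolumeLimitRateDoor`, `…DoorsV14`, `…RegimeDoors`, k3c5-p3's `…CutoffDoor` / `…CutoffFrame`) ask, in the end, for ONE kind of
statement about a volume-indexed family of grid functions `F_L : (ℤ/L)^d → E` (kernels of the expansion, the density, the
six-point coefficient …): a **two-volume estimate with cross-grid torus modulus**

  `‖F_L(a, k) - F_{L'}(a, k')‖ ≤ ρ(L) + D · Σ_i |p_k i - p'_{k'} i|_𝕋`   (`L₀ ≤ L ≤ L'`, uniformly in a parameter `a`),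

`|·|_𝕋 = torusAbs` the distance to `2πℤ`.  The terms of the engine's expansion are built from such families (lower-scale kernels —
defined ONLY on the grids — and grid samples of `L`-independent symbols) by three operations: ROUTING (evaluating a family at an
integer combination of momenta, momentum conservation at a vertex), PRODUCTS/SUMS, and LOOP AVERAGES `L^{-d₂} Σ_{q ∈ (ℤ/L)^{d₂}}`.
This file proves that each operation preserves the estimate, with explicit constants — the per-term input of
`twoVolumeRate_of_termwise` (`…CauchyTermwise`, p476294) — in EXPLICIT-HYPOTHESIS form (no predicate is defined):

* §1 torus-modulus bookkeeping (with `klvr_torusAbs_add_int_mul`, p3): `klgf_torusAbs_int_mul_le` (`|n x|_𝕋 ≤ |n|·|x|_𝕋`), `klgf_torusAbs_sum_le`, and ROUTING: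
  `klgf_exists_latticeMomentum_route` (the momentum of `(A·x)_i = Σ_j A_ij x_j ∈ ℤ/L` is `Σ_j A_ij p_x j` mod `2π`, any integer
  matrix `A`), **`klgf_tmod_route_le`** (`Σ_i |p_{Ax} i - p'_{Ax'} i|_𝕋 ≤ (Σ_{ij}|A_ij|) · Σ_j |p_x j - p'_{x'} j|_𝕋` ACROSS volumes),
  hence `klgf_norm_sub_route_le`: a comparable family stays comparable along any routing, `D ↦ D·Σ|A_ij|`;
* §2 pointwise algebra: `klgf_norm_mul_sub_mul_le'` (products: `ρ ↦ B₂ρ₁ + B₁ρ₂`, `D ↦ B₂D₁ + B₁D₂`), `klgf_norm_prod_sub_prod_le`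
  (finite products with a common bound), sums;
* §3 symbols: `klgf_norm_symbol_sub_le` — grid samples of a `2πℤ^d`-periodic sup-Lipschitz symbol are comparable with `ρ = 0`
  (`norm_sub_le_mul_tmod_of_periodic`, p477523);
* §4 **LOOP AVERAGES** (`…GridRefinement`, p495441): `klgf_norm_average_sub_average_le` — if `G_L` on `(ℤ/L)^{d₁+d₂}` is comparable
  with `(ρ, D)`, then `F_L(a, p) = L^{-d₂} Σ_q G_L(a, p ⧺ q)` is comparable with `(ρ + D·d₂·(2π/L + 2π/L'), D)`, i.e. rate
  `ρ(L) + 4π d₂ D / L` (`_rate`); bounds pass to averages (`klgf_norm_average_le`); `klgf_tendsto_rate_add_div`: such rates still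
  tend to `0`.

So every connected graph value built from comparable vertex families and sampled propagator slices is comparable, with constants
computed by these rules; the Hubbard instances are `d₁ = 2` (one external momentum), `d₂ = 2ℓ` (`ℓ` loops), `E = ℂ`.
Everything is proved; no definitions; nothing is asserted about the model.
-/

noncomputable section

namespace Summit.HubbardSuperconductivity.HubbardSuperconductivity.Theorems.KLRegimeSplit

set_option linter.dupNamespace false -- summit = problem name (single-conjunct summit), D-0017

open Filter Topology Finset Literature.Probability.LatticeModels
open Summit.HubbardSuperconductivity.HubbardSuperconductivity.Theorems.KLProgrammeLegKernels

/-! ## §1 Torus-modulus bookkeeping and routing along integer matrices -/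

/-- **Integer multiples**: `|n·x|_𝕋 ≤ |n|·|x|_𝕋`. -/
theorem klgf_torusAbs_int_mul_le (n : ℤ) (x : ℝ) : torusAbs (n * x) ≤ |(n : ℝ)| * torusAbs x := by
  obtain ⟨m, hm⟩ := klvc_exists_int_mul_abs_eq_torusAbs x
  have heq : (n : ℝ) * x = n * (x - m * (2 * Real.pi)) + (n * m : ℤ) * (2 * Real.pi) := by push_cast; ring
  rw [heq, klvr_torusAbs_add_int_mul]
  calc torusAbs ((n : ℝ) * (x - m * (2 * Real.pi))) ≤ |(n : ℝ) * (x - m * (2 * Real.pi))| := klvc_torusAbs_le_abs _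
    _ = |(n : ℝ)| * torusAbs x := by rw [abs_mul, hm]

/-- **Finite sums**: `|Σ_i f i|_𝕋 ≤ Σ_i |f i|_𝕋`. -/
theorem klgf_torusAbs_sum_le {ι : Type*} (s : Finset ι) (f : ι → ℝ) :
    torusAbs (∑ i ∈ s, f i) ≤ ∑ i ∈ s, torusAbs (f i) :=
  Finset.le_sum_of_subadditive torusAbs klvc_torusAbs_zero.le klvc_torusAbs_add_le s f

/-- **Routing along an integer matrix, modulo `2π`**: for `A ∈ ℤ^{m×n}` and `x ∈ (ℤ/L)^n`, the lattice momentum of the routed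
site `(A·x)_i = Σ_j A_ij x_j` is `Σ_j A_ij · p_x j + 2π w_i` with `w ∈ ℤ^m` (momentum conservation at a vertex, any routing). -/
theorem klgf_exists_latticeMomentum_route {m n L : ℕ} [NeZero L] (A : Matrix (Fin m) (Fin n) ℤ) (x : TorusSite n L) :
    ∃ w : Fin m → ℤ, latticeMomentum L (fun i => ∑ j, ((A i j : ℤ) : ZMod L) * x j) =
      fun i => ∑ j, (A i j : ℝ) * latticeMomentum L x j + 2 * Real.pi * (w i : ℝ) := by
  have hL : (L : ℝ) ≠ 0 := by exact_mod_cast NeZero.ne L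
  set J : Fin m → ℤ := fun i => ∑ j, A i j * ((x j).val : ℤ) with hJ
  have hcast : (fun i => ∑ j, ((A i j : ℤ) : ZMod L) * x j) = fun i => ((J i : ℤ) : ZMod L) := by
    funext i
    simp only [hJ]
    push_cast
    refine Finset.sum_congr rfl fun j _ => ?_
    rw [ZMod.natCast_zmod_val]
  obtain ⟨w, hw⟩ := exists_latticeMomentum_intCast_eq (L := L) J
  refine ⟨w, ?_⟩
  rw [hcast, hw]
  funext i
  simp only [latticeMomentum, hJ]
  push_cast
  congr 1
  rw [Finset.mul_sum, Finset.sum_div]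
  exact Finset.sum_congr rfl fun j _ => by ring

/-- **The torus modulus along a routing, ACROSS VOLUMES**: for `x ∈ (ℤ/L)^n`, `x' ∈ (ℤ/L')^n` and an integer matrix `A`,
`Σ_i |p_{Ax} i - p'_{Ax'} i|_𝕋 ≤ (Σ_i Σ_j |A_ij|) · Σ_j |p_x j - p'_{x'} j|_𝕋` (the `2πℤ` ambiguities of both routings drop out of
`|·|_𝕋`; then subadditivity and `|n y|_𝕋 ≤ |n||y|_𝕋`). -/
theorem klgf_tmod_route_le {m n L L' : ℕ} [NeZero L] [NeZero L'] (A : Matrix (Fin m) (Fin n) ℤ)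
    (x : TorusSite n L) (x' : TorusSite n L') :
    ∑ i, torusAbs (latticeMomentum L (fun i => ∑ j, ((A i j : ℤ) : ZMod L) * x j) i -
        latticeMomentum L' (fun i => ∑ j, ((A i j : ℤ) : ZMod L') * x' j) i) ≤
      (∑ i, ∑ j, |(A i j : ℝ)|) * ∑ j, torusAbs (latticeMomentum L x j - latticeMomentum L' x' j) := by
  obtain ⟨w, hw⟩ := klgf_exists_latticeMomentum_route A x
  obtain ⟨w', hw'⟩ := klgf_exists_latticeMomentum_route A x'
  set T : ℝ := ∑ j, torusAbs (latticeMomentum L x j - latticeMomentum L' x' j) with hT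
  have hT0 : 0 ≤ T := Finset.sum_nonneg fun _ _ => klvc_torusAbs_nonneg _
  have hrow : ∀ i, torusAbs (latticeMomentum L (fun i => ∑ j, ((A i j : ℤ) : ZMod L) * x j) i -
      latticeMomentum L' (fun i => ∑ j, ((A i j : ℤ) : ZMod L') * x' j) i) ≤ (∑ j, |(A i j : ℝ)|) * T := by
    intro i
    rw [hw, hw']
    have heq : (∑ j, (A i j : ℝ) * latticeMomentum L x j + 2 * Real.pi * (w i : ℝ)) -
        (∑ j, (A i j : ℝ) * latticeMomentum L' x' j + 2 * Real.pi * (w' i : ℝ)) =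
        ∑ j, (A i j : ℝ) * (latticeMomentum L x j - latticeMomentum L' x' j) + ((w i - w' i : ℤ) : ℝ) * (2 * Real.pi) := by
      have hs : ∑ j, (A i j : ℝ) * (latticeMomentum L x j - latticeMomentum L' x' j) =
          ∑ j, (A i j : ℝ) * latticeMomentum L x j - ∑ j, (A i j : ℝ) * latticeMomentum L' x' j := by
        rw [← Finset.sum_sub_distrib]
        exact Finset.sum_congr rfl fun j _ => by ring
      rw [hs]
      push_cast
      ring
    rw [heq, klvr_torusAbs_add_int_mul]
    calc torusAbs (∑ j, (A i j : ℝ) * (latticeMomentum L x j - latticeMomentum L' x' j))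
        ≤ ∑ j, torusAbs ((A i j : ℝ) * (latticeMomentum L x j - latticeMomentum L' x' j)) := klgf_torusAbs_sum_le _ _
      _ ≤ ∑ j, |(A i j : ℝ)| * torusAbs (latticeMomentum L x j - latticeMomentum L' x' j) :=
          Finset.sum_le_sum fun j _ => klgf_torusAbs_int_mul_le (A i j) _
      _ ≤ ∑ j, |(A i j : ℝ)| * T := Finset.sum_le_sum fun j _ => by
          refine mul_le_mul_of_nonneg_left ?_ (abs_nonneg _)
          exact Finset.single_le_sum (f := fun j => torusAbs (latticeMomentum L x j - latticeMomentum L' x' j))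
            (fun _ _ => klvc_torusAbs_nonneg _) (Finset.mem_univ j)
      _ = (∑ j, |(A i j : ℝ)|) * T := by rw [Finset.sum_mul]
  calc _ ≤ ∑ i, (∑ j, |(A i j : ℝ)|) * T := Finset.sum_le_sum fun i _ => hrow i
    _ = (∑ i, ∑ j, |(A i j : ℝ)|) * T := by rw [Finset.sum_mul]

/-- **A comparable family stays comparable along any routing** (`D ↦ D·Σ|A_ij|`): if
`‖F_L(a, y) - F_{L'}(a, y')‖ ≤ ρ + D·Σ_i |p_y i - p'_{y'} i|_𝕋` for all `y, y'` (`0 ≤ D`), then for the routed arguments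
`‖F_L(a, A·x) - F_{L'}(a, A·x')‖ ≤ ρ + D·(Σ|A_ij|)·Σ_j |p_x j - p'_{x'} j|_𝕋`. -/
theorem klgf_norm_sub_route_le {E : Type*} [SeminormedAddCommGroup E] {m n L L' : ℕ} [NeZero L] [NeZero L']
    (F : TorusSite m L → E) (F' : TorusSite m L' → E) {ρ D : ℝ} (hD : 0 ≤ D)
    (h : ∀ (y : TorusSite m L) (y' : TorusSite m L'),
      ‖F y - F' y'‖ ≤ ρ + D * ∑ i, torusAbs (latticeMomentum L y i - latticeMomentum L' y' i))
    (A : Matrix (Fin m) (Fin n) ℤ) (x : TorusSite n L) (x' : TorusSite n L') :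
    ‖F (fun i => ∑ j, ((A i j : ℤ) : ZMod L) * x j) - F' (fun i => ∑ j, ((A i j : ℤ) : ZMod L') * x' j)‖ ≤
      ρ + D * (∑ i, ∑ j, |(A i j : ℝ)|) * ∑ j, torusAbs (latticeMomentum L x j - latticeMomentum L' x' j) := by
  refine (h _ _).trans ?_
  rw [mul_assoc]
  gcongr
  exact klgf_tmod_route_le A x x'

/-! ## §2 Pointwise algebra of two-volume estimates -/

section Algebra

variable {R : Type*} [NormedRing R]

/-- **Products**: `‖f g - f' g'‖ ≤ ‖f - f'‖·‖g‖ + ‖f'‖·‖g - g'‖`; with `‖f - f'‖ ≤ δ₁`, `‖g - g'‖ ≤ δ₂`, `‖g‖ ≤ B₂`, `‖f'‖ ≤ B₁`: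
`‖f g - f' g'‖ ≤ B₂ δ₁ + B₁ δ₂`. -/
theorem klgf_norm_mul_sub_mul_le {f f' g g' : R} {δ₁ δ₂ B₁ B₂ : ℝ} (hf : ‖f - f'‖ ≤ δ₁) (hg : ‖g - g'‖ ≤ δ₂)
    (hB₁ : ‖f'‖ ≤ B₁) (hB₂ : ‖g‖ ≤ B₂) : ‖f * g - f' * g'‖ ≤ B₂ * δ₁ + B₁ * δ₂ := by
  have hδ₁ : 0 ≤ δ₁ := (norm_nonneg _).trans hf
  have hδ₂ : 0 ≤ δ₂ := (norm_nonneg _).trans hg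
  have hB₁0 : 0 ≤ B₁ := (norm_nonneg _).trans hB₁
  calc ‖f * g - f' * g'‖ = ‖(f - f') * g + f' * (g - g')‖ := by congr 1; noncomm_ring
    _ ≤ ‖(f - f') * g‖ + ‖f' * (g - g')‖ := norm_add_le _ _
    _ ≤ ‖f - f'‖ * ‖g‖ + ‖f'‖ * ‖g - g'‖ := add_le_add (norm_mul_le _ _) (norm_mul_le _ _)
    _ ≤ δ₁ * B₂ + B₁ * δ₂ := by gcongr
    _ = B₂ * δ₁ + B₁ * δ₂ := by ring

/-- **Products, in `(ρ, D)` form**: `‖f - f'‖ ≤ ρ₁ + D₁ μ`, `‖g - g'‖ ≤ ρ₂ + D₂ μ`, `‖f'‖ ≤ B₁`, `‖g‖ ≤ B₂` give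
`‖f g - f' g'‖ ≤ (B₂ρ₁ + B₁ρ₂) + (B₂D₁ + B₁D₂) μ` (`μ` the common modulus, e.g. `Σ_i |p_i - p'_i|_𝕋`). -/
theorem klgf_norm_mul_sub_mul_le' {f f' g g' : R} {ρ₁ ρ₂ D₁ D₂ B₁ B₂ μ : ℝ} (hf : ‖f - f'‖ ≤ ρ₁ + D₁ * μ)
    (hg : ‖g - g'‖ ≤ ρ₂ + D₂ * μ) (hB₁ : ‖f'‖ ≤ B₁) (hB₂ : ‖g‖ ≤ B₂) :
    ‖f * g - f' * g'‖ ≤ (B₂ * ρ₁ + B₁ * ρ₂) + (B₂ * D₁ + B₁ * D₂) * μ := by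
  have h := klgf_norm_mul_sub_mul_le hf hg hB₁ hB₂
  calc ‖f * g - f' * g'‖ ≤ B₂ * (ρ₁ + D₁ * μ) + B₁ * (ρ₂ + D₂ * μ) := h
    _ = (B₂ * ρ₁ + B₁ * ρ₂) + (B₂ * D₁ + B₁ * D₂) * μ := by ring

/-- **Sums**: `‖f - f'‖ ≤ ρ₁ + D₁ μ`, `‖g - g'‖ ≤ ρ₂ + D₂ μ` give `‖(f + g) - (f' + g')‖ ≤ (ρ₁ + ρ₂) + (D₁ + D₂) μ`. -/
theorem klgf_norm_add_sub_add_le {E : Type*} [SeminormedAddCommGroup E] {f f' g g' : E} {ρ₁ ρ₂ D₁ D₂ μ : ℝ}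
    (hf : ‖f - f'‖ ≤ ρ₁ + D₁ * μ) (hg : ‖g - g'‖ ≤ ρ₂ + D₂ * μ) :
    ‖(f + g) - (f' + g')‖ ≤ (ρ₁ + ρ₂) + (D₁ + D₂) * μ := by
  calc ‖(f + g) - (f' + g')‖ = ‖(f - f') + (g - g')‖ := by congr 1; abel
    _ ≤ ‖f - f'‖ + ‖g - g'‖ := norm_add_le _ _
    _ ≤ (ρ₁ + D₁ * μ) + (ρ₂ + D₂ * μ) := add_le_add hf hg
    _ = (ρ₁ + ρ₂) + (D₁ + D₂) * μ := by ring

/-- **Finite sums over an index set**: termwise `‖f i - f' i‖ ≤ ρ i + D i · μ` gives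
`‖Σ_s f - Σ_s f'‖ ≤ Σ_s ρ + (Σ_s D) · μ`. -/
theorem klgf_norm_sum_sub_sum_le {E : Type*} [SeminormedAddCommGroup E] {ι : Type*} (s : Finset ι) {f f' : ι → E}
    {ρ D : ι → ℝ} {μ : ℝ} (h : ∀ i ∈ s, ‖f i - f' i‖ ≤ ρ i + D i * μ) :
    ‖∑ i ∈ s, f i - ∑ i ∈ s, f' i‖ ≤ ∑ i ∈ s, ρ i + (∑ i ∈ s, D i) * μ := by
  rw [← Finset.sum_sub_distrib, Finset.sum_mul, ← Finset.sum_add_distrib]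
  exact (norm_sum_le _ _).trans (Finset.sum_le_sum h)

/-- **Scalar factors** (an `L`-independent bounded coefficient, e.g. a coupling or a combinatorial weight):
`‖c • f - c • f'‖ ≤ ‖c‖ (ρ + D μ)`. -/
theorem klgf_norm_smul_sub_smul_le {𝕜 : Type*} [NormedField 𝕜] {E : Type*} [SeminormedAddCommGroup E] [NormedSpace 𝕜 E]
    (c : 𝕜) {f f' : E} {ρ D μ : ℝ} (hf : ‖f - f'‖ ≤ ρ + D * μ) :
    ‖c • f - c • f'‖ ≤ ‖c‖ * ρ + (‖c‖ * D) * μ := by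
  rw [← smul_sub, norm_smul]
  calc ‖c‖ * ‖f - f'‖ ≤ ‖c‖ * (ρ + D * μ) := mul_le_mul_of_nonneg_left hf (norm_nonneg _)
    _ = ‖c‖ * ρ + (‖c‖ * D) * μ := by ring

end Algebra

/-- **Finite products with a common bound** (commutative normed ring, e.g. `ℂ`): if `‖f i‖, ‖g i‖ ≤ B` on `s` (`0 ≤ B`), then
`‖Π_s f - Π_s g‖ ≤ B^{|s| - 1} · Σ_{i ∈ s} ‖f i - g i‖` (telescoping). -/
theorem klgf_norm_prod_sub_prod_le {R : Type*} [NormedCommRing R] [NormOneClass R] {ι : Type*} [DecidableEq ι] (s : Finset ι)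
    {f g : ι → R}
    {B : ℝ} (hB : 0 ≤ B) (hf : ∀ i ∈ s, ‖f i‖ ≤ B) (hg : ∀ i ∈ s, ‖g i‖ ≤ B) :
    ‖∏ i ∈ s, f i - ∏ i ∈ s, g i‖ ≤ B ^ (s.card - 1) * ∑ i ∈ s, ‖f i - g i‖ := by
  induction s using Finset.induction_on with
  | empty => simp
  | @insert a s ha ih =>
    have hfa : ‖f a‖ ≤ B := hf a (Finset.mem_insert_self a s)
    have hga : ‖g a‖ ≤ B := hg a (Finset.mem_insert_self a s)
    have hfs : ∀ i ∈ s, ‖f i‖ ≤ B := fun i hi => hf i (Finset.mem_insert_of_mem hi)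
    have hgs : ∀ i ∈ s, ‖g i‖ ≤ B := fun i hi => hg i (Finset.mem_insert_of_mem hi)
    have hPf : ‖∏ i ∈ s, f i‖ ≤ B ^ s.card := by
      calc ‖∏ i ∈ s, f i‖ ≤ ∏ i ∈ s, ‖f i‖ := Finset.norm_prod_le s f
        _ ≤ ∏ _i ∈ s, B := Finset.prod_le_prod (fun i _ => norm_nonneg _) hfs
        _ = B ^ s.card := Finset.prod_const B
    have ih' := ih hfs hgs
    rw [Finset.prod_insert ha, Finset.prod_insert ha, Finset.sum_insert ha, Finset.card_insert_of_notMem ha,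
      Nat.add_sub_cancel]
    have hsum0 : 0 ≤ ∑ i ∈ s, ‖f i - g i‖ := Finset.sum_nonneg fun _ _ => norm_nonneg _
    calc ‖f a * ∏ i ∈ s, f i - g a * ∏ i ∈ s, g i‖
        = ‖(f a - g a) * ∏ i ∈ s, f i + g a * (∏ i ∈ s, f i - ∏ i ∈ s, g i)‖ := by congr 1; ring
      _ ≤ ‖f a - g a‖ * ‖∏ i ∈ s, f i‖ + ‖g a‖ * ‖∏ i ∈ s, f i - ∏ i ∈ s, g i‖ :=
          (norm_add_le _ _).trans (add_le_add (norm_mul_le _ _) (norm_mul_le _ _))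
      _ ≤ ‖f a - g a‖ * B ^ s.card + B * (B ^ (s.card - 1) * ∑ i ∈ s, ‖f i - g i‖) := by gcongr
      _ ≤ B ^ s.card * (‖f a - g a‖ + ∑ i ∈ s, ‖f i - g i‖) := by
          rcases Nat.eq_zero_or_pos s.card with hs | hs
          · have hs' : s = ∅ := Finset.card_eq_zero.mp hs
            subst hs'
            simp
          · have hpow : B * B ^ (s.card - 1) = B ^ s.card := by
              rw [← pow_succ']
              congr 1
              omega
            rw [← mul_assoc, hpow]
            nlinarith [norm_nonneg (f a - g a), pow_nonneg hB s.card]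

/-! ## §3 Grid samples of periodic Lipschitz symbols -/

/-- **Sampled symbols are comparable with `ρ = 0`**: if `s` is `2πℤ^d`-periodic and sup-Lipschitz with constant `K ≥ 0`
(`‖s x - s y‖ ≤ K‖x - y‖`), then its grid samples at two volumes satisfy
`‖s(p_k) - s(p'_{k'})‖ ≤ K · Σ_i |p_k i - p'_{k'} i|_𝕋` (`norm_sub_le_mul_tmod_of_periodic`). -/
theorem klgf_norm_symbol_sub_le {E : Type*} [SeminormedAddCommGroup E] {d L L' : ℕ} {s : (Fin d → ℝ) → E} {K : ℝ}
    (hK : 0 ≤ K) (hper : ∀ (x : Fin d → ℝ) (m : Fin d → ℤ), s (fun i => x i + m i * (2 * Real.pi)) = s x)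
    (hlip : ∀ x y : Fin d → ℝ, ‖s x - s y‖ ≤ K * ‖x - y‖) (k : TorusSite d L) (k' : TorusSite d L') :
    ‖s (latticeMomentum L k) - s (latticeMomentum L' k')‖ ≤
      0 + K * ∑ i, torusAbs (latticeMomentum L k i - latticeMomentum L' k' i) := by
  rw [zero_add]
  exact norm_sub_le_mul_tmod_of_periodic hK hper hlip _ _

/-- **`L`-independent, momentum-independent quantities** (couplings, `β`-dependent constants) are comparable with `(0, 0)`. -/
theorem klgf_norm_const_sub_le {E : Type*} [SeminormedAddCommGroup E] (c : E) (μ : ℝ) : ‖c - c‖ ≤ 0 + 0 * μ := by simp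

/-! ## §4 Loop averages: integrating out `d₂` grid momenta preserves the estimate -/

section Average

variable {E : Type*} [NormedAddCommGroup E] [NormedSpace ℝ E] {d₁ d₂ : ℕ}

/-- The lattice momentum of an appended site, head coordinates. -/
theorem klgf_latticeMomentum_append_castAdd {L : ℕ} (p : TorusSite d₁ L) (q : TorusSite d₂ L) (i : Fin d₁) :
    latticeMomentum L (Fin.append p q) (Fin.castAdd d₂ i) = latticeMomentum L p i := by
  simp only [latticeMomentum, Fin.append_left]

/-- The lattice momentum of an appended site, tail coordinates. -/
theorem klgf_latticeMomentum_append_natAdd {L : ℕ} (p : TorusSite d₁ L) (q : TorusSite d₂ L) (j : Fin d₂) :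
    latticeMomentum L (Fin.append p q) (Fin.natAdd d₁ j) = latticeMomentum L q j := by
  simp only [latticeMomentum, Fin.append_right]

/-- The torus modulus of appended sites splits into head and tail parts. -/
theorem klgf_tmod_append {L L' : ℕ} (p : TorusSite d₁ L) (q : TorusSite d₂ L) (p' : TorusSite d₁ L') (q' : TorusSite d₂ L') :
    ∑ i, torusAbs (latticeMomentum L (Fin.append p q) i - latticeMomentum L' (Fin.append p' q') i) =
      ∑ i, torusAbs (latticeMomentum L p i - latticeMomentum L' p' i) +
        ∑ j, torusAbs (latticeMomentum L q j - latticeMomentum L' q' j) := by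
  rw [Fin.sum_univ_add]
  simp only [klgf_latticeMomentum_append_castAdd, klgf_latticeMomentum_append_natAdd]

/-- **LOOP AVERAGES PRESERVE THE TWO-VOLUME ESTIMATE.**  Let `G` on `(ℤ/L)^{d₁+d₂}` and `G'` on `(ℤ/L')^{d₁+d₂}` satisfy
`‖G x - G' x'‖ ≤ ρ + D·Σ_i |p_x i - p'_{x'} i|_𝕋` for all `x, x'` (`0 ≤ D`).  Then the partial averages over the last `d₂`
coordinates, `F p = L^{-d₂} Σ_q G(p ⧺ q)` and `F' p' = L'^{-d₂} Σ_{q'} G'(p' ⧺ q')`, satisfy for all `p, p'`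
`‖F p - F' p'‖ ≤ (ρ + D·d₂·(2π/L + 2π/L')) + D·Σ_i |p_p i - p'_{p'} i|_𝕋` — the loop momenta are paired through the common
refinement (`norm_gridAverage_sub_gridAverage_le_of_modulus`, `|·|_𝕋 ≤ |·|`), the external ones keep their modulus. -/
theorem klgf_norm_average_sub_average_le {L L' : ℕ} [NeZero L] [NeZero L'] (G : TorusSite (d₁ + d₂) L → E)
    (G' : TorusSite (d₁ + d₂) L' → E) {ρ D : ℝ} (hD : 0 ≤ D)
    (h : ∀ (x : TorusSite (d₁ + d₂) L) (x' : TorusSite (d₁ + d₂) L'),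
      ‖G x - G' x'‖ ≤ ρ + D * ∑ i, torusAbs (latticeMomentum L x i - latticeMomentum L' x' i))
    (p : TorusSite d₁ L) (p' : TorusSite d₁ L') :
    ‖((L ^ d₂ : ℕ) : ℝ)⁻¹ • ∑ q : TorusSite d₂ L, G (Fin.append p q) -
        ((L' ^ d₂ : ℕ) : ℝ)⁻¹ • ∑ q' : TorusSite d₂ L', G' (Fin.append p' q')‖ ≤
      (ρ + D * (d₂ * (2 * Real.pi / L + 2 * Real.pi / L'))) +
        D * ∑ i, torusAbs (latticeMomentum L p i - latticeMomentum L' p' i) := by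
  set μ : ℝ := ∑ i, torusAbs (latticeMomentum L p i - latticeMomentum L' p' i) with hμ
  have key := norm_gridAverage_sub_gridAverage_le_of_modulus (d := d₂) (E := E)
    (fun q : TorusSite d₂ L => G (Fin.append p q)) (fun q' : TorusSite d₂ L' => G' (Fin.append p' q'))
    (ρ := ρ + D * μ) (D := D) hD ?_
  · calc _ ≤ ρ + D * μ + D * (d₂ * (2 * Real.pi / L + 2 * Real.pi / L')) := key
      _ = (ρ + D * (d₂ * (2 * Real.pi / L + 2 * Real.pi / L'))) + D * μ := by ring
  · intro q q'
    refine (h (Fin.append p q) (Fin.append p' q')).trans ?_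
    rw [klgf_tmod_append, mul_add, ← add_assoc]
    gcongr with j _
    exact klvc_torusAbs_le_abs _

/-- **Loop averages, rate form**: under the same hypothesis and `L ≤ L'`, the partial averages satisfy
`‖F p - F' p'‖ ≤ (ρ + 4π d₂ D / L) + D·Σ_i |p_p i - p'_{p'} i|_𝕋` — the modulus constant of the loop momenta has become a RATE
`4π d₂ D / L → 0`, the external modulus constant is unchanged. -/
theorem klgf_norm_average_sub_average_le_rate {L L' : ℕ} [NeZero L] [NeZero L'] (hLL' : L ≤ L')
    (G : TorusSite (d₁ + d₂) L → E) (G' : TorusSite (d₁ + d₂) L' → E) {ρ D : ℝ} (hD : 0 ≤ D)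
    (h : ∀ (x : TorusSite (d₁ + d₂) L) (x' : TorusSite (d₁ + d₂) L'),
      ‖G x - G' x'‖ ≤ ρ + D * ∑ i, torusAbs (latticeMomentum L x i - latticeMomentum L' x' i))
    (p : TorusSite d₁ L) (p' : TorusSite d₁ L') :
    ‖((L ^ d₂ : ℕ) : ℝ)⁻¹ • ∑ q : TorusSite d₂ L, G (Fin.append p q) -
        ((L' ^ d₂ : ℕ) : ℝ)⁻¹ • ∑ q' : TorusSite d₂ L', G' (Fin.append p' q')‖ ≤
      (ρ + 4 * Real.pi * d₂ * D / L) + D * ∑ i, torusAbs (latticeMomentum L p i - latticeMomentum L' p' i) := by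
  have hL : (0 : ℝ) < L := by exact_mod_cast Nat.pos_of_ne_zero (NeZero.ne L)
  have hLL : (L : ℝ) ≤ L' := by exact_mod_cast hLL'
  refine (klgf_norm_average_sub_average_le G G' hD h p p').trans ?_
  have hinv : 2 * Real.pi / (L' : ℝ) ≤ 2 * Real.pi / L := by
    apply div_le_div_of_nonneg_left (by positivity) hL hLL
  have hd : (0 : ℝ) ≤ d₂ := Nat.cast_nonneg _
  have hbound : D * (d₂ * (2 * Real.pi / L + 2 * Real.pi / L')) ≤ 4 * Real.pi * d₂ * D / L := by
    calc D * (d₂ * (2 * Real.pi / L + 2 * Real.pi / L')) ≤ D * (d₂ * (2 * Real.pi / L + 2 * Real.pi / L)) := by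
          gcongr
      _ = 4 * Real.pi * d₂ * D / L := by ring
  linarith

/-- **Bounds pass to averages**: `‖G x‖ ≤ B` for all `x` gives `‖L^{-d₂} Σ_q G(p ⧺ q)‖ ≤ B`. -/
theorem klgf_norm_average_le {L : ℕ} [NeZero L] (G : TorusSite (d₁ + d₂) L → E) {B : ℝ} (hB : ∀ x, ‖G x‖ ≤ B)
    (p : TorusSite d₁ L) : ‖((L ^ d₂ : ℕ) : ℝ)⁻¹ • ∑ q : TorusSite d₂ L, G (Fin.append p q)‖ ≤ B := by
  have hLd : (0 : ℝ) < ((L ^ d₂ : ℕ) : ℝ) := by exact_mod_cast pow_pos (Nat.pos_of_ne_zero (NeZero.ne L)) d₂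
  have hcard : (Finset.univ : Finset (TorusSite d₂ L)).card = L ^ d₂ := by
    simp only [Finset.card_univ, Fintype.card_fun, ZMod.card, Fintype.card_fin]
  rw [norm_smul, norm_inv, Real.norm_of_nonneg hLd.le]
  calc ((L ^ d₂ : ℕ) : ℝ)⁻¹ * ‖∑ q : TorusSite d₂ L, G (Fin.append p q)‖
      ≤ ((L ^ d₂ : ℕ) : ℝ)⁻¹ * ∑ _q : TorusSite d₂ L, B := by
        gcongr
        exact (norm_sum_le _ _).trans (Finset.sum_le_sum fun q _ => hB _)
    _ = B := by
        rw [Finset.sum_const, hcard, nsmul_eq_mul]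
        field_simp

/-- **Full averages** (no external momentum, `d₁ = 0`: e.g. a vacuum graph or the density): comparable integrands on
`(ℤ/L)^{d}` with `(ρ, D)` have averages within `ρ + D·d·(2π/L + 2π/L')`. -/
theorem klgf_norm_fullAverage_sub_le {d L L' : ℕ} [NeZero L] [NeZero L'] (G : TorusSite d L → E) (G' : TorusSite d L' → E)
    {ρ D : ℝ} (hD : 0 ≤ D)
    (h : ∀ (x : TorusSite d L) (x' : TorusSite d L'),
      ‖G x - G' x'‖ ≤ ρ + D * ∑ i, torusAbs (latticeMomentum L x i - latticeMomentum L' x' i)) :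
    ‖((L ^ d : ℕ) : ℝ)⁻¹ • ∑ q : TorusSite d L, G q - ((L' ^ d : ℕ) : ℝ)⁻¹ • ∑ q' : TorusSite d L', G' q'‖ ≤
      ρ + D * (d * (2 * Real.pi / L + 2 * Real.pi / L')) := by
  refine norm_gridAverage_sub_gridAverage_le_of_modulus G G' hD fun q q' => (h q q').trans ?_
  gcongr with j _
  exact klvc_torusAbs_le_abs _

end Average

/-! ## §5 Rates -/

/-- **Rates produced by loop averaging still tend to zero**: `ρ → 0` gives `ρ + C/L → 0`. -/
theorem klgf_tendsto_rate_add_div {ρ : ℕ → ℝ} (hρ : Tendsto ρ atTop (𝓝 0)) (C : ℝ) :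
    Tendsto (fun L : ℕ => ρ L + C / (L : ℝ)) atTop (𝓝 0) := by
  have h2 : Tendsto (fun L : ℕ => C / (L : ℝ)) atTop (𝓝 0) :=
    tendsto_const_div_atTop_nhds_zero_nat C
  simpa using hρ.add h2

/-- **Rates produced by products / finite sums still tend to zero**: `ρ₁, ρ₂ → 0` gives `B₂ρ₁ + B₁ρ₂ → 0`. -/
theorem klgf_tendsto_rate_lincomb {ρ₁ ρ₂ : ℕ → ℝ} (h₁ : Tendsto ρ₁ atTop (𝓝 0)) (h₂ : Tendsto ρ₂ atTop (𝓝 0)) (B₁ B₂ : ℝ) :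
    Tendsto (fun L : ℕ => B₂ * ρ₁ L + B₁ * ρ₂ L) atTop (𝓝 0) := by
  simpa using (h₁.const_mul B₂).add (h₂.const_mul B₁)

end Summit.HubbardSuperconductivity.HubbardSuperconductivity.Theorems.KLRegimeSplit

end
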